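import Summits.CriticalPhenomena.PercolationContinuityZ3.Theorems.PercNearOneGluingNoHeavyLowerTailSahiThreeCopyCellCheck

/-!
# `NoHeavyLowerTail` (crux stmt-CriticalPhenomena-4575), Sahi programme: **CELL CERTIFICATES IV — TRANSPORT of cell facts along symmetries
# of the slot, TRANSPOSITION, and the computational symmetry check**

Support file (Sahi cell, seat `prim-sahi-p1`, generation 65; `--supports stmt-CriticalPhenomena-4575`); companion of `…CellCheck` (`CellFacts`,
`pointwiseTP_of_cellFacts`).  No evaluation in this file; no `sorry`, standard axioms.

CONTENT.  A cell certificate is computed (by the Γ-invariant LPs of memo FROM-prim-sahi-p1-gen64 §9) for ONE representative of each orbit of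
ordered cells under the symmetry group of the slot; the other cells follow by TRANSPORT.  Here: `permPt τ` (relabelling levels by a coordinate
permutation `τ`), `isArr_permPt` (arrangements are preserved when `π ∘ τ = π`), ★ `N1form_comp_permPt` / `N2form_comp_permPt` (the forms at
relabelled level functions equal the forms with the relabelled weight `θ ∘ Φ_τ⁻¹`), ★ `N2form_swap` ((N2) is symmetric in its two level functions,
by the arrangement symmetry `e₂ ↔ e₃`), hence ★★ `cellFacts_transport` (facts for `(P,Q)` ⇒ facts for `(βP, βQ)` when `τ` fixes profile and slot
and the scores are equivariant, `ℓ_j = ℓ_{βj} ∘ Φ_τ`) and ★ `cellFacts_transpose` (`(P,Q) ⇒ (Q,P)`); `pointwiseTP_of_exists_cellFacts`.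
Finally `SymData` (`τ`, `τ⁻¹`, `β` as lists), the Boolean ★ `symCheck` (inverse bijections fixing `π`; slot invariant; scores equivariant — on all
`2^k` codes) and ★ `exists_cellFacts_transport` (a checked symmetry transports cell facts). [this work]
-/

namespace Summit.CriticalPhenomena.PercolationContinuityZ3.Theorems.SahiThreeCopy

open Finset Function Literature.Combinatorics.Sahi2008
open scoped BigOperators

variable {k : ℕ}

/-! ### Transport of cell facts along symmetries of the slot (coordinate permutations) and transposition -/

/-- Relabelling levels by a coordinate permutation: `(Φ_τ e)_i = e_{τ i}`. [this work] -/
def permPt (τ : Equiv.Perm (Fin k)) (e : Pt k) : Pt k := fun i => e (τ i)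

/-- `Φ_τ ∘ Φ_{τ⁻¹} = id`. [this work] -/
@[simp] theorem permPt_symm_apply (τ : Equiv.Perm (Fin k)) (e : Pt k) : permPt τ (permPt τ.symm e) = e := by
  funext i; simp [permPt]

/-- `Φ_{τ⁻¹} ∘ Φ_τ = id`. [this work] -/
@[simp] theorem permPt_apply_symm (τ : Equiv.Perm (Fin k)) (e : Pt k) : permPt τ.symm (permPt τ e) = e := by
  funext i; simp [permPt]

/-- `Φ_τ` as an equivalence of the level set. [this work] -/
def permPtEquiv (τ : Equiv.Perm (Fin k)) : Pt k ≃ Pt k :=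
  ⟨permPt τ, permPt τ.symm, permPt_apply_symm τ, permPt_symm_apply τ⟩

/-- `Φ_τ` is monotone. [this work] -/
theorem permPt_mono (τ : Equiv.Perm (Fin k)) : Monotone (permPt (k := k) τ) := fun _ _ h i => h (τ i)

/-- Arrangements are preserved by a coordinate permutation fixing the profile. [this work] -/
theorem isArr_permPt {π : Fin k → ℕ} (τ : Equiv.Perm (Fin k)) (hπ : ∀ i, π (τ i) = π i) (x y z : Pt k) :
    IsArr π (permPt τ x) (permPt τ y) (permPt τ z) ↔ IsArr π x y z := by
  unfold IsArr permPt
  constructor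
  · intro h j
    have h1 := h (τ.symm j)
    have h2 := hπ (τ.symm j)
    simp only [Equiv.apply_symm_apply] at h1 h2
    rw [h1, ← h2]
  · intro h i
    rw [← hπ i]; exact h (τ i)

/-- The arrangement indicator is invariant. [this work] -/
theorem arrInd_permPt {π : Fin k → ℕ} (τ : Equiv.Perm (Fin k)) (hπ : ∀ i, π (τ i) = π i) (x y z : Pt k) :
    arrInd π (permPt τ x) (permPt τ y) (permPt τ z) = arrInd π x y z := by
  unfold arrInd; exact if_congr (isArr_permPt τ hπ x y z) rfl rfl

/-- Linear scores under relabelling: `Σ_e ℓ(e) φ(Φ e) = Σ_e ℓ(Φ⁻¹ e) φ(e)`. [this work] -/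
theorem sum_mul_comp_permPt (τ : Equiv.Perm (Fin k)) (ℓ φ : Pt k → ℝ) :
    ∑ e, ℓ e * φ (permPt τ e) = ∑ e, ℓ (permPt τ.symm e) * φ e :=
  Fintype.sum_equiv (permPtEquiv τ) _ _ fun e => by simp [permPtEquiv]

/-- ★ (N2) under relabelling of both level functions by a symmetry of `(π, f)`. [this work] -/
theorem N2form_comp_permPt {π : Fin k → ℕ} (τ : Equiv.Perm (Fin k)) (hπ : ∀ i, π (τ i) = π i) (f : Pt k → ℝ)
    (hf : ∀ e, f (permPt τ e) = f e) (θ : Pt k → Pt k → Pt k → ℝ) (φ ψ : Pt k → ℝ) :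
    N2form k π f θ (φ ∘ permPt τ) (ψ ∘ permPt τ) =
      N2form k π f (fun a b c => θ (permPt τ.symm a) (permPt τ.symm b) (permPt τ.symm c)) φ ψ := by
  unfold N2form
  refine Fintype.sum_equiv ((permPtEquiv τ).prodCongr ((permPtEquiv τ).prodCongr (permPtEquiv τ))) _ _ fun σ => ?_
  simp only [Equiv.prodCongr_apply, Prod.map, permPtEquiv, Equiv.coe_fn_mk, Function.comp, arrInd_permPt τ hπ,
    permPt_apply_symm, hf]

/-- ★ (N1) (against `1`) under relabelling. [this work] -/
theorem N1form_comp_permPt {π : Fin k → ℕ} (τ : Equiv.Perm (Fin k)) (hπ : ∀ i, π (τ i) = π i) (f : Pt k → ℝ)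
    (hf : ∀ e, f (permPt τ e) = f e) (θ : Pt k → Pt k → Pt k → ℝ) (κ : Pt k → ℝ) :
    N1form k π f θ (κ ∘ permPt τ) 1 =
      N1form k π f (fun a b c => θ (permPt τ.symm a) (permPt τ.symm b) (permPt τ.symm c)) κ 1 := by
  unfold N1form
  refine Fintype.sum_equiv ((permPtEquiv τ).prodCongr ((permPtEquiv τ).prodCongr (permPtEquiv τ))) _ _ fun σ => ?_
  simp only [Equiv.prodCongr_apply, Prod.map, permPtEquiv, Equiv.coe_fn_mk, Function.comp, arrInd_permPt τ hπ,
    permPt_apply_symm, hf, Pi.one_apply]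

/-- ★ (N2) is SYMMETRIC in the two level functions (for every `θ`): the arrangement symmetry `e₂ ↔ e₃`. [this work] -/
theorem N2form_swap (π : Fin k → ℕ) (f : Pt k → ℝ) (θ : Pt k → Pt k → Pt k → ℝ) (φ ψ : Pt k → ℝ) :
    N2form k π f θ ψ φ = N2form k π f θ φ ψ := by
  unfold N2form
  have cross : ∑ σ : Pt k × Pt k × Pt k, arrInd π σ.1 σ.2.1 σ.2.2 * (f σ.1 * (ψ σ.2.1 * φ σ.2.2)) =
      ∑ σ : Pt k × Pt k × Pt k, arrInd π σ.1 σ.2.1 σ.2.2 * (f σ.1 * (φ σ.2.1 * ψ σ.2.2)) := by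
    refine Fintype.sum_equiv ((Equiv.refl (Pt k)).prodCongr (Equiv.prodComm (Pt k) (Pt k))) _ _ fun σ => ?_
    simp only [Equiv.prodCongr_apply, Prod.map, Equiv.refl_apply, Equiv.prodComm_apply, Prod.fst_swap, Prod.snd_swap]
    have : arrInd π σ.1 σ.2.2 σ.2.1 = arrInd π σ.1 σ.2.1 σ.2.2 := by
      unfold arrInd; refine if_congr ?_ rfl rfl
      unfold IsArr; exact forall_congr' fun i => by constructor <;> intro h <;> omega
    rw [this]; ring
  have split : ∀ (a b : Pt k → ℝ), ∑ σ : Pt k × Pt k × Pt k, arrInd π σ.1 σ.2.1 σ.2.2 *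
      (θ σ.1 σ.2.1 σ.2.2 * (a σ.1 * b σ.1) + f σ.1 * (a σ.2.1 * b σ.2.2) - f σ.2.1 * (a σ.1 * b σ.2.1) - f σ.2.1 * (a σ.2.1 * b σ.1)) =
      ∑ σ : Pt k × Pt k × Pt k, arrInd π σ.1 σ.2.1 σ.2.2 * (f σ.1 * (a σ.2.1 * b σ.2.2)) +
      ∑ σ : Pt k × Pt k × Pt k, arrInd π σ.1 σ.2.1 σ.2.2 *
        (θ σ.1 σ.2.1 σ.2.2 * (a σ.1 * b σ.1) - f σ.2.1 * (a σ.1 * b σ.2.1) - f σ.2.1 * (a σ.2.1 * b σ.1)) := by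
    intro a b; rw [← sum_add_distrib]; exact sum_congr rfl fun σ _ => by ring
  rw [split, split, cross]
  congr 1
  exact sum_congr rfl fun σ _ => by ring

/-- ★★ TRANSPORT OF CELL FACTS along a symmetry: if `τ` fixes the profile and the slot, and the scores are EQUIVARIANT
(`ℓ_j = ℓ_{β j} ∘ Φ_τ`, `β` mapping blocks `< M` to blocks `< M`), then facts for the cell `(P, Q)` give facts for `(β P, β Q)`
with the relabelled weight. [this work] -/
theorem cellFacts_transport {π : Fin k → ℕ} {f : Pt k → ℝ} {M : ℕ} {ℓ : ℕ → Pt k → ℝ} {P Q : ℕ} {θ : Pt k → Pt k → Pt k → ℝ}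
    (τ : Equiv.Perm (Fin k)) (β : ℕ → ℕ) (hπ : ∀ i, π (τ i) = π i) (hf : ∀ e, f (permPt τ e) = f e)
    (hℓ : ∀ j, j < M → β j < M ∧ ∀ e, ℓ j e = ℓ (β j) (permPt τ e)) (hP : P < M) (hQ : Q < M)
    (h : CellFacts k π f M ℓ P Q θ) :
    CellFacts k π f M ℓ (β P) (β Q) (fun a b c => θ (permPt τ.symm a) (permPt τ.symm b) (permPt τ.symm c)) := by
  obtain ⟨hθ, hN1, hN2⟩ := h
  -- a score sum of a relabelled function is the sum for the image block
  have hsc : ∀ j, j < M → ∀ φ : Pt k → ℝ, ∑ e, ℓ j e * (φ ∘ permPt τ) e = ∑ e, ℓ (β j) e * φ e := by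
    intro j hj φ
    have h1 : ∀ e, ℓ j e * (φ ∘ permPt τ) e = ℓ (β j) (permPt τ e) * φ (permPt τ e) := fun e => by
      rw [(hℓ j hj).2 e]; rfl
    simp only [h1]
    exact Fintype.sum_equiv (permPtEquiv τ) _ _ fun e => by simp [permPtEquiv]
  refine ⟨fun _ _ _ => hθ _ _ _, fun κ hκ0 hκm => ?_, fun φ ψ hφ hψ hφm hψm hφc hψc => ?_⟩
  · rw [← N1form_comp_permPt τ hπ f hf θ κ]
    exact hN1 (κ ∘ permPt τ) (fun e => hκ0 _) (hκm.comp (permPt_mono τ))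
  · rw [← N2form_comp_permPt τ hπ f hf θ φ ψ]
    refine hN2 (φ ∘ permPt τ) (ψ ∘ permPt τ) (fun e => hφ _) (fun e => hψ _) (hφm.comp (permPt_mono τ))
      (hψm.comp (permPt_mono τ)) (fun j hj => ?_) (fun j hj => ?_)
    · rw [hsc j hj, hsc P hP]; exact hφc (β j) (hℓ j hj).1
    · rw [hsc j hj, hsc Q hQ]; exact hψc (β j) (hℓ j hj).1

/-- ★ TRANSPOSITION OF CELL FACTS: facts for `(P, Q)` give facts for `(Q, P)` with the same weight ((N2) is symmetric). [this work] -/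
theorem cellFacts_transpose {π : Fin k → ℕ} {f : Pt k → ℝ} {M : ℕ} {ℓ : ℕ → Pt k → ℝ} {P Q : ℕ} {θ : Pt k → Pt k → Pt k → ℝ}
    (h : CellFacts k π f M ℓ P Q θ) : CellFacts k π f M ℓ Q P θ := by
  obtain ⟨hθ, hN1, hN2⟩ := h
  refine ⟨hθ, hN1, fun φ ψ hφ hψ hφm hψm hφc hψc => ?_⟩
  rw [← N2form_swap]
  exact hN2 ψ φ hψ hφ hψm hφm hψc hφc

/-- Cell facts up to the choice of the weight. [this work] -/
theorem pointwiseTP_of_exists_cellFacts {π : Fin k → ℕ} {f : Pt k → ℝ} {M : ℕ} (hM : 0 < M) (ℓ : ℕ → Pt k → ℝ)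
    (h : ∀ p q, p < M → q < M → ∃ θ, CellFacts k π f M ℓ p q θ) : PointwiseTP k π f := by
  classical
  refine pointwiseTP_of_cellFacts hM ℓ (fun p q => if hpq : p < M ∧ q < M then Classical.choose (h p q hpq.1 hpq.2) else fun _ _ _ => 0)
    fun p q hp hq => ?_
  simp only [hp, hq, and_self, dif_pos]
  exact Classical.choose_spec (h p q hp hq)

/-! ### Symmetry data, checked by computation -/

/-- A candidate symmetry: a coordinate map `τ` and its inverse as lists of images, and the block map `β`. [this work] -/
structure SymData where
  /-- `τ i` -/ tau : List ℕ
  /-- `τ⁻¹ i` -/ tauInv : List ℕ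
  /-- `β j` -/ beta : List ℕ

/-- A list of images as a total map `Fin k → Fin k` (junk `i ↦ i` outside range). [this work] -/
def finMapOfList (k : ℕ) (l : List ℕ) (i : Fin k) : Fin k :=
  if h : l.getD i.val 0 < k then ⟨l.getD i.val 0, h⟩ else i

/-- Relabelling by a plain coordinate map (computable twin of `permPt`). [this work] -/
def permPtF (g : Fin k → Fin k) (e : Pt k) : Pt k := fun i => e (g i)

/-- ★ THE SYMMETRY CHECK: `τ`, `τ⁻¹` are inverse bijections fixing the profile; the slot is `τ`-invariant; the scores are
equivariant (`ℓ_j = ℓ_{β j} ∘ Φ_τ`) with `β` mapping blocks `< M` into blocks `< M` — all on the `2^k` point codes. [this work] -/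
def symCheck (k : ℕ) (π : Fin k → ℕ) (fZ : Pt k → ℤ) (ℓZ : ℕ → Pt k → ℤ) (M : ℕ) (S : SymData) : Bool :=
  let τ := finMapOfList k S.tau
  let τi := finMapOfList k S.tauInv
  (List.finRange k).all (fun i => τi (τ i) == i && τ (τi i) == i && π (τ i) == π i)
  && (List.range (2 ^ k)).all (fun n => fZ (permPtF τ (ptOfCode k n)) == fZ (ptOfCode k n))
  && (List.range M).all (fun j => decide (S.beta.getD j 0 < M) &&
      (List.range (2 ^ k)).all fun n => ℓZ j (ptOfCode k n) == ℓZ (S.beta.getD j 0) (permPtF τ (ptOfCode k n)))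

/-- The permutation of a symmetry datum that passed the check. [this work] -/
def SymData.perm (k : ℕ) (S : SymData) (h₁ : ∀ i, finMapOfList k S.tauInv (finMapOfList k S.tau i) = i)
    (h₂ : ∀ i, finMapOfList k S.tau (finMapOfList k S.tauInv i) = i) : Equiv.Perm (Fin k) :=
  ⟨finMapOfList k S.tau, finMapOfList k S.tauInv, h₁, h₂⟩

/-- ★ SOUNDNESS OF THE SYMMETRY CHECK + TRANSPORT: a checked symmetry carries cell facts from `(P, Q)` to `(β P, β Q)`. [this work] -/
theorem exists_cellFacts_transport {π : Fin k → ℕ} {fZ : Pt k → ℤ} {ℓZ : ℕ → Pt k → ℤ} {M : ℕ} {S : SymData}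
    (hS : symCheck k π fZ ℓZ M S = true) (P Q : ℕ) (hP : P < M) (hQ : Q < M)
    (h : ∃ θ, CellFacts k π (fun x => (fZ x : ℝ)) M (fun j e => (ℓZ j e : ℝ)) P Q θ) :
    ∃ θ, CellFacts k π (fun x => (fZ x : ℝ)) M (fun j e => (ℓZ j e : ℝ)) (S.beta.getD P 0) (S.beta.getD Q 0) θ := by
  obtain ⟨θ, hθ⟩ := h
  unfold symCheck at hS
  simp only [Bool.and_eq_true, List.all_eq_true, List.mem_finRange, true_implies, beq_iff_eq, List.mem_range,
    decide_eq_true_eq] at hS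
  obtain ⟨⟨hτ, hf⟩, hℓ⟩ := hS
  let τ : Equiv.Perm (Fin k) := S.perm k (fun i => (hτ i).1.1) (fun i => (hτ i).1.2)
  have hperm : ∀ e : Pt k, permPt τ e = permPtF (finMapOfList k S.tau) e := fun e => rfl
  refine ⟨_, cellFacts_transport τ (fun j => S.beta.getD j 0) (fun i => (hτ i).2) (fun e => ?_) (fun j hj => ⟨(hℓ j hj).1, fun e => ?_⟩)
    hP hQ hθ⟩
  · have := hf (codeOf k e) (codeOf_lt k e)
    rw [ptOfCode_codeOf] at this
    rw [hperm]; exact_mod_cast this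
  · have := (hℓ j hj).2 (codeOf k e) (codeOf_lt k e)
    rw [ptOfCode_codeOf] at this
    rw [hperm]; exact_mod_cast this

end Summit.CriticalPhenomena.PercolationContinuityZ3.Theorems.SahiThreeCopy
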